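import Summits.PneNP.PneNP.Theorems.ConvexRankGatesMixedBasisSynthesisGlue
import Summits.PneNP.PneNP.Theorems.LinAlgGateBlind.Negative.ValiantCertificate

/-!
# `CliqueExtLowerBound` (stmt-PneNP-10682, route PneNP/ConvexRankGates) — the barrier certificate

A `--supports` file (closes nothing) recording, by NAME and sorry-free, the line-independent
necessary conditions that every proof of crux #5 `CliqueExtLowerBound` must meet, assembled only
from landed theorems of the tree:

* `requires_doors` — #5 implies crux #2 `ConvexGateBlind` AND crux #4 `LinAlgGateBlind`
  (sub-bases; `convexGateBlind_of_cliqueExtLowerBound`, `linAlgGateBlind_of_cliqueExtLowerBound`).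
* `iff_doors_of_glue` — modulo the glue item `MixedBasisSynthesis` (stmt-PneNP-14728), #5 is
  EXACTLY #2 ∧ #4 (`mixedBasisSynthesis_iff_cliqueExtLowerBound_iff`).
* `requires_dc_lowerBound`, `requires_determinantalComplexity` — the VALIANT CERTIFICATE: #5 implies,
  for its `δ`, over EVERY field `F` and for every `c`, eventually in `m`, that the clique polynomial
  `CL_{m,⌈m^δ⌉₊}` has no affine determinantal representation of size `≤ m^c`
  (`dc_cliquePoly_superpolynomial_of_linAlgGateBlind` of the sibling crux composed with
  `requires_doors`): any proof of #5 is a superpolynomial determinantal-complexity lower bound for an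
  explicit family in every characteristic.
* `not_cliqueExtLowerBound_of_not_door`, `not_cliqueExtLowerBound_of_hasDetRepr` — the refutation
  interfaces: a refutation of either door, or polynomial-size determinantal representations of the
  clique polynomials at every `δ ∈ (0,1/2)` infinitely often over some field, refute #5 in one line.

Lead prover c7 of the crux chain, 2026-08-16 (the same facts were attached as evidence by lead c4;
this file puts them in the tree so that later seats find them with `lean search`).
-/

set_option linter.dupNamespace false

namespace Summit.PneNP.PneNP.Theorems.CliqueExtLowerBound.Barrier

open Filter Literature.Computability.Complexity
open Summit.PneNP.PneNP.Theses.ConvexRankGates (CliqueExtLowerBound LinAlgGateBlind ConvexGateBlind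
  MixedBasisSynthesis)
open Summit.PneNP.PneNP.Theorems.LinAlgGateBlind.Negative
  (cliquePoly dc_cliquePoly_superpolynomial_of_linAlgGateBlind
    determinantalComplexity_cliquePoly_of_linAlgGateBlind)

/-- **Both doors are necessary.** Crux #5 `CliqueExtLowerBound` implies crux #2 `ConvexGateBlind`
and crux #4 `LinAlgGateBlind` of the same route (a circuit over a sub-basis is a circuit over the
full basis `B_{m^c}`, same `δ`, same `c`). [folklore] -/
theorem requires_doors (h : CliqueExtLowerBound) : ConvexGateBlind ∧ LinAlgGateBlind :=
  ⟨convexGateBlind_of_cliqueExtLowerBound h, linAlgGateBlind_of_cliqueExtLowerBound h⟩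

/-- **Modulo the glue item, #5 is exactly #2 ∧ #4.** If `MixedBasisSynthesis` (stmt-PneNP-14728)
holds then `CliqueExtLowerBound ↔ ConvexGateBlind ∧ LinAlgGateBlind`. [folklore] -/
theorem iff_doors_of_glue (hglue : MixedBasisSynthesis) :
    CliqueExtLowerBound ↔ (ConvexGateBlind ∧ LinAlgGateBlind) :=
  mixedBasisSynthesis_iff_cliqueExtLowerBound_iff.1 hglue

/-- **Valiant certificate of crux #5 (affine determinantal representations).** If
`CliqueExtLowerBound` holds then, for its exponent `δ ∈ (0,1/2)`, over EVERY field `F` and for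
every `c`, eventually in `m`: the clique polynomial `CL_{m,⌈m^δ⌉₊}` has no affine determinantal
representation of size `d ≤ m^c`. So any proof of the crux proves a superpolynomial
determinantal-complexity lower bound for an explicit polynomial family in every characteristic
(Valiant 1979 territory; best proved explicit bound quadratic, Mignon–Ressayre 2004). [folklore] -/
theorem requires_dc_lowerBound : Summit.PneNP.PneNP.Theses.ConvexRankGates.CliqueExtLowerBound →
    ∃ δ : ℝ, 0 < δ ∧ δ < 1 / 2 ∧ ∀ (F : Type) [Field F] (c : ℕ), ∀ᶠ m : ℕ in atTop, ∀ d ≤ m ^ c,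
      ¬ Literature.Computability.AlgebraicComplexity.HasDetRepr
        (Summit.PneNP.PneNP.Theorems.LinAlgGateBlind.Negative.cliquePoly m F ⌈(m : ℝ) ^ δ⌉₊) d :=
  fun h => dc_cliquePoly_superpolynomial_of_linAlgGateBlind (linAlgGateBlind_of_cliqueExtLowerBound h)

/-- **Valiant certificate of crux #5 (determinantal complexity).** If `CliqueExtLowerBound` holds
then, for its `δ`, over every field and for every `c`, eventually `m^c < dc (CL_{m,⌈m^δ⌉₊})`.
[folklore] -/
theorem requires_determinantalComplexity (h : CliqueExtLowerBound) :
    ∃ δ : ℝ, 0 < δ ∧ δ < 1 / 2 ∧ ∀ (F : Type) [Field F] (c : ℕ), ∀ᶠ m : ℕ in atTop,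
      m ^ c < Literature.Computability.AlgebraicComplexity.determinantalComplexity
        (cliquePoly m F ⌈(m : ℝ) ^ δ⌉₊) :=
  determinantalComplexity_cliquePoly_of_linAlgGateBlind (linAlgGateBlind_of_cliqueExtLowerBound h)

/-- **Refutation interface, doors.** A refutation of crux #2 or of crux #4 refutes crux #5.
[folklore] -/
theorem not_cliqueExtLowerBound_of_not_door (h : ¬ ConvexGateBlind ∨ ¬ LinAlgGateBlind) :
    ¬ CliqueExtLowerBound := fun h5 =>
  h.elim (fun h2 => h2 (requires_doors h5).1) fun h4 => h4 (requires_doors h5).2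

/-- **Refutation interface, determinantal representations.** If for EVERY `δ ∈ (0,1/2)` there are a
field `F` and an exponent `c` such that, for infinitely many `m`, the clique polynomial
`CL_{m,⌈m^δ⌉₊}` over `F` has an affine determinantal representation of size `≤ m^c`, then crux #5
is false (each such representation is ONE GRANK gate computing the clique function). [folklore] -/
theorem not_cliqueExtLowerBound_of_hasDetRepr
    (h : ∀ δ : ℝ, 0 < δ → δ < 1 / 2 → ∃ (F : Type) (_ : Field F) (c : ℕ), ∃ᶠ m : ℕ in atTop,
      ∃ d ≤ m ^ c,
        Literature.Computability.AlgebraicComplexity.HasDetRepr (cliquePoly m F ⌈(m : ℝ) ^ δ⌉₊) d) :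
    ¬ CliqueExtLowerBound := by
  intro h5
  obtain ⟨δ, hδ0, hδ1, hall⟩ := requires_dc_lowerBound h5
  obtain ⟨F, _, c, hfreq⟩ := h δ hδ0 hδ1
  refine hfreq ?_
  filter_upwards [hall F c] with m hm hex
  obtain ⟨d, hd, hrepr⟩ := hex
  exact hm d hd hrepr

end Summit.PneNP.PneNP.Theorems.CliqueExtLowerBound.Barrier
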